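import Mathlib.GroupTheory.FiniteAbelian.Basic
import Mathlib.GroupTheory.Torsion
import Mathlib.LinearAlgebra.Dimension.Finite
import Mathlib.LinearAlgebra.Dimension.Constructions
import Mathlib.RingTheory.Finiteness.Cardinality
import HarnessLib

/-!
# Killing a finitely generated abelian group by rank and torsion steps (Kervaire–Milnor's
# "Proof of Theorem 5.1 for `k` even")

Elementary book-keeping on finitely generated abelian groups, recorded in general form because it
is the whole logical skeleton of one printed proof: M. Kervaire, J. Milnor, *Groups of homotopy
spheres I*, Ann. of Math. (2) 77 (1963), §5, Lemma 5.7 (p. 516) and "Proof of Theorem 5.1 for `k`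
even" (pp. 518–519). There the groups are the middle homology groups `H_kM` of the manifolds `M`
obtained from a given one by spherical modifications, and three geometric inputs are used as
black boxes: (i) a generator `λ` of an infinite cyclic direct summand of `H_kM` can be killed —
some modification `M'` has `H_kM' ≅ H_kM/λ(Z)` (Lemma 5.6, Assertion p. 516, and Poincaré duality,
proof of Lemma 5.7); (ii) for every non-zero `λ` some modification has `H_kM/λ(Z) ≅ H_kM'/λ'(Z)`
(Lemma 5.6) and (iii) a different `k`ᵗʰ Betti number (Lemma 5.8, `k` even). Abstracting the
manifolds to "stages" `i : ι` satisfying a predicate `P` and carrying finitely generated abelian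
groups `G i`, this file PROVES:

* `exists_addEquiv_torsion_of_killFree` — **Lemma 5.7** ("`H_kM` can be reduced to its torsion
  subgroup by a sequence of spherical modifications. The modified manifold `M₁` will still satisfy
  the hypothesis") from (i): induction on the rank, using that killing such a `λ` lowers the rank
  by one (`finrank_quotient_zmultiples_add_one`) and does not change the torsion subgroup
  (`nonempty_torsion_quotient_zmultiples_addEquiv_torsion`), a generator of a free summand
  existing in positive rank (`exists_addMonoidHom_apply_eq_one_of_finrank_ne_zero`, structure
  theorem);
* `exists_subsingleton_of_torsionStep_of_rankStep` — **the iteration of pp. 518–519** ("in two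
  steps one can replace `H_kM` by a smaller group. Iterating this construction a finite number of
  times, the group `H_kM` can be killed completely") from Lemma 5.7 (as a hypothesis on stages)
  together with (ii) + (iii): a finite group has rank `0` (`finrank_int_eq_zero_of_finite`), so
  after a modification of non-zero `λ` the new `λ'` has infinite order
  (`finite_of_finite_quotient_zmultiples`), the torsion subgroup then embeds in
  `H_kM'/λ'(Z) ≅ H_kM/λ(Z)` (`injective_torsion_to_quotient_zmultiples`) and is smaller than
  `H_kM`; strong induction on the order.

Ranks are `Module.finrank ℤ` (the Betti number of a finitely generated abelian group), "`≅`" is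
`≃+`, `λ(Z)` is `AddSubgroup.zmultiples λ`, the torsion subgroup is `AddCommGroup.torsion`.
Consumer: `Literature/Topology/FourManifolds/ThetaFourKervaireMilnorProofs.lean` (Thm. 5.1 at
`k = 2`, `bP₅ = 0`). Everything here is proved; no definitions.

## References

* M. Kervaire, J. Milnor, *Groups of homotopy spheres I*, Ann. of Math. (2) 77 (1963), 504–537:
  Lemma 5.7 (p. 516) and its proof, "Proof of Theorem 5.1 for `k` even" (pp. 518–519).
  doi:10.2307/1970128 [KervaireMilnorAnnals1963]
-/

open AddSubgroup

namespace Literature.GroupTheory.FiniteAbelian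

/-! ### Rank and torsion of finitely generated abelian groups -/

/-- A finite abelian group has rank zero (every element is killed by the order of the group).
[folklore] -/
theorem finrank_int_eq_zero_of_finite (N : Type*) [AddCommGroup N] [Finite N] :
    Module.finrank ℤ N = 0 := by
  haveI : Module.Finite ℤ N := Module.Finite.of_finite
  refine Module.finrank_eq_zero_iff.2 fun x => ⟨(Nat.card N : ℤ), ?_, ?_⟩
  · haveI : Nonempty N := ⟨x⟩
    exact_mod_cast Nat.card_pos.ne'
  · rw [Nat.cast_smul_eq_nsmul]
    exact card_nsmul_eq_zero'

/-- An abelian group with finite quotient by the multiples of an element of finite order is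
finite (Lagrange). [folklore] -/
theorem finite_of_finite_quotient_zmultiples {N : Type*} [AddCommGroup N] {y : N}
    (hy : IsOfFinAddOrder y) [Finite (N ⧸ zmultiples y)] : Finite N := by
  apply Nat.finite_of_card_ne_zero
  rw [(zmultiples y).card_eq_card_quotient_mul_card_addSubgroup, Nat.card_zmultiples]
  exact mul_ne_zero Nat.card_pos.ne' hy.addOrderOf_pos.ne'

/-- **"The torsion subgroup of `H_kM'` maps monomorphically into `H_kM'/λ'(Z)`"** (Kervaire–Milnor
1963, p. 519) when `λ' = y` has infinite order: a torsion element `b • y` of `λ'(Z)` has `b = 0`.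
[cite: KervaireMilnorAnnals1963, proof of Thm. 5.1 for k even (p. 519)] -/
theorem injective_torsion_to_quotient_zmultiples {N : Type*} [AddCommGroup N] {y : N}
    (hy : ¬IsOfFinAddOrder y) :
    Function.Injective ((QuotientAddGroup.mk' (zmultiples y)).comp
      (AddCommGroup.torsion N).subtype) := by
  intro s t hst
  rw [AddMonoidHom.comp_apply, AddMonoidHom.comp_apply, QuotientAddGroup.mk'_apply,
    QuotientAddGroup.mk'_apply, QuotientAddGroup.eq_iff_sub_mem, mem_zmultiples_iff] at hst
  obtain ⟨b, hb⟩ := hst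
  -- `s - t = b • y` is of finite order; hence `b = 0`, `y` being of infinite order
  have hfin : IsOfFinAddOrder (b • y) := by
    rw [hb, ← map_sub]
    exact (AddCommGroup.mem_torsion _).1 (s - t).2
  obtain ⟨n, hn, hnb⟩ := (isOfFinAddOrder_iff_nsmul_eq_zero).1 hfin
  have hinj := injective_zsmul_iff_not_isOfFinAddOrder.2 hy
  have hb0 : (n : ℤ) * b = 0 := by
    apply hinj
    dsimp only
    rw [mul_smul, natCast_zsmul, hnb, zero_smul]
  have hb0' : b = 0 := by
    rcases mul_eq_zero.1 hb0 with h | h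
    · exact absurd h (by exact_mod_cast hn.ne')
    · exact h
  rw [hb0', zero_smul, eq_comm, sub_eq_zero] at hb
  exact Subtype.ext hb

/-- **A generator of an infinite cyclic direct summand** of a finitely generated abelian group of
positive rank: an element `x` and a homomorphism `f` onto `ℤ` with `f x = 1` (structure theorem;
Kervaire–Milnor 1963, proof of Lemma 5.7: "Suppose that `H_kM ≅ Z ⊕ ⋯ ⊕ Z ⊕ T` where `T` is the
torsion subgroup. Let `λ` generate one of the infinite cyclic summands"). [folklore] -/
theorem exists_addMonoidHom_apply_eq_one_of_finrank_ne_zero (N : Type*) [AddCommGroup N]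
    [AddGroup.FG N] (h : Module.finrank ℤ N ≠ 0) : ∃ (x : N) (f : N →+ ℤ), f x = 1 := by
  obtain ⟨n, κ, _, p, hp, e, ⟨φ⟩⟩ := AddCommGroup.equiv_free_prod_directSum_zmod N
  haveI : ∀ i, NeZero (p i ^ e i) := fun i => ⟨pow_ne_zero _ (hp i).ne_zero⟩
  haveI : Finite (DirectSum κ fun i => ZMod (p i ^ e i)) :=
    Finite.of_equiv _ DFinsupp.equivFunOnFintype.symm
  rcases n with - | m
  · exfalso
    haveI : Finite (Fin 0 →₀ ℤ) := Finite.of_subsingleton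
    haveI : Finite N := Finite.of_equiv _ φ.toEquiv.symm
    exact h (finrank_int_eq_zero_of_finite N)
  · refine ⟨φ.symm (Finsupp.single 0 1, 0),
      (Finsupp.applyAddHom 0).comp ((AddMonoidHom.fst _ _).comp φ.toAddMonoidHom), ?_⟩
    simp

/-- **Torsion is unchanged by killing a generator of a free summand**: if `f x = 1` for a
homomorphism `f : N → ℤ`, the quotient map identifies the torsion subgroup of `N` with that of
`N / xℤ` (Kervaire–Milnor 1963, proof of Lemma 5.7: "one obtains a manifold `M₁` with
`H_kM₁ ≅ T ⊂ H_kM`"). Injective because a torsion element `b • x` has `b = f (b • x) = 0`; onto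
because a class of order `m` represented by `g` has `m • g = b • x` with `b = m · f g`, so that
`g - (f g) • x` is a torsion representative. [folklore] -/
theorem nonempty_torsion_quotient_zmultiples_addEquiv_torsion {N : Type*} [AddCommGroup N] {x : N}
    {f : N →+ ℤ} (hfx : f x = 1) :
    Nonempty (AddCommGroup.torsion (N ⧸ zmultiples x) ≃+ AddCommGroup.torsion N) := by
  -- the quotient map restricted to the torsion subgroups
  let q : N →+ N ⧸ zmultiples x := QuotientAddGroup.mk' (zmultiples x)
  have hmem : ∀ t : AddCommGroup.torsion N, q t ∈ AddCommGroup.torsion (N ⧸ zmultiples x) :=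
    fun t => (AddCommGroup.mem_torsion _).2 (q.isOfFinAddOrder ((AddCommGroup.mem_torsion _).1 t.2))
  let t : AddCommGroup.torsion N →+ AddCommGroup.torsion (N ⧸ zmultiples x) :=
    (q.comp (AddCommGroup.torsion N).subtype).codRestrict _ hmem
  -- `f` kills every element of finite order and `f (b • x) = b`
  have hf0 : ∀ y : N, IsOfFinAddOrder y → f y = 0 := fun y hy =>
    (f.isOfFinAddOrder hy).eq_zero'
  refine ⟨(AddEquiv.ofBijective t ⟨?_, ?_⟩).symm⟩
  · -- injective: a torsion element of `xℤ` is `0`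
    intro s s' hss'
    have h1 : q s = q s' := congrArg Subtype.val hss'
    rw [QuotientAddGroup.mk'_apply, QuotientAddGroup.mk'_apply, QuotientAddGroup.eq_iff_sub_mem,
      mem_zmultiples_iff] at h1
    obtain ⟨b, hb⟩ := h1
    have hb0 : b = 0 := by
      have h2 := hf0 _ ((AddCommGroup.mem_torsion _).1 (s - s').2)
      rw [AddSubgroup.coe_sub, ← hb, map_zsmul, hfx, smul_eq_mul, mul_one] at h2
      exact h2
    rw [hb0, zero_smul, eq_comm, sub_eq_zero] at hb
    exact Subtype.ext hb
  · -- surjective: a class of finite order `m` has a torsion representative `g - f g • x`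
    rintro ⟨c, hc⟩
    induction c using QuotientAddGroup.induction_on with
    | H g =>
      obtain ⟨m, hm, hmg⟩ :=
        (isOfFinAddOrder_iff_nsmul_eq_zero).1 ((AddCommGroup.mem_torsion _).1 hc)
      -- `m • g = b • x` for some `b`, and then `b = m * f g`
      have hmg' : ((m • g : N) : N ⧸ zmultiples x) = 0 := by
        rw [QuotientAddGroup.mk_nsmul]; exact hmg
      rw [QuotientAddGroup.eq_zero_iff, mem_zmultiples_iff] at hmg'
      obtain ⟨b, hb⟩ := hmg'
      have hb' : b = m * f g := by
        have := congrArg f hb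
        rw [map_zsmul, hfx, smul_eq_mul, mul_one, map_nsmul, nsmul_eq_mul] at this
        exact this
      refine ⟨⟨g - f g • x, (AddCommGroup.mem_torsion _).2
        ((isOfFinAddOrder_iff_nsmul_eq_zero).2 ⟨m, hm, ?_⟩)⟩, ?_⟩
      · have hmx : m • (f g • x) = m • g := by rw [← hb, hb', ← smul_smul, natCast_zsmul]
        rw [nsmul_sub, hmx, sub_self]
      · apply Subtype.ext
        change q (g - f g • x) = (g : N ⧸ zmultiples x)
        rw [map_sub, QuotientAddGroup.mk'_apply, QuotientAddGroup.mk'_apply, sub_eq_self,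
          QuotientAddGroup.eq_zero_iff]
        exact zsmul_mem (mem_zmultiples x) _

/-- **The rank drops by one when a generator of a free summand is killed**: if `f x = 1` then
`rank (N / xℤ) + 1 = rank N` for a finitely generated `N` (Kervaire–Milnor 1963, proof of
Lemma 5.7: after killing `λ`, "`H_kM₁ ≅ H_kM/λ(Z)`" has one infinite cyclic summand fewer):
`ℤ ∙ x` is free of rank one (`f (a • x) = a`) and rank–nullity. [folklore] -/
theorem finrank_quotient_zmultiples_add_one {N : Type*} [AddCommGroup N] [AddGroup.FG N] {x : N}
    {f : N →+ ℤ} (hfx : f x = 1) :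
    Module.finrank ℤ (N ⧸ zmultiples x) + 1 = Module.finrank ℤ N := by
  haveI : Module.Finite ℤ N := Module.Finite.iff_addGroup_fg.2 ‹_›
  -- the submodule `ℤ ∙ x` has rank one
  have hli : LinearIndependent ℤ (fun _ : Unit => x) := by
    rw [linearIndependent_iff']
    intro s g hg i hi
    have hsum := congrArg f hg
    rw [map_sum, map_zero] at hsum
    simp only [map_zsmul, hfx, smul_eq_mul, mul_one] at hsum
    have hs : s = {i} :=
      Finset.eq_singleton_iff_unique_mem.2 ⟨hi, fun j _ => Subsingleton.elim _ _⟩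
    rw [hs, Finset.sum_singleton] at hsum
    exact hsum
  have h1 : Module.finrank ℤ (Submodule.span ℤ (Set.range fun _ : Unit => x)) = 1 := by
    rw [finrank_span_eq_card hli, Fintype.card_unit]
  have hrange : Set.range (fun _ : Unit => x) = {x} := Set.range_const
  rw [hrange] at h1
  -- rank–nullity
  have h2 := (Submodule.span ℤ ({x} : Set N)).finrank_quotient_add_finrank
  rw [h1] at h2
  -- the module quotient `N ⧸ ℤ ∙ x` is the group quotient `N ⧸ xℤ`
  have hS : (Submodule.span ℤ ({x} : Set N)).toAddSubgroup = zmultiples x := by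
    rw [Submodule.span_int_eq_addSubgroupClosure, zmultiples_eq_closure]
  have e : (N ⧸ Submodule.span ℤ ({x} : Set N)) ≃+ N ⧸ zmultiples x :=
    QuotientAddGroup.quotientAddEquivOfEq hS
  have h3 := e.toIntLinearEquiv.finrank_eq
  rw [← h2, ← h3]
  -- the two `ℤ`-module structures on the quotient agree
  congr 2

/-! ### Kervaire–Milnor's Lemma 5.7 and the iteration of pp. 518–519, as algebra of stages -/

/-- **Kervaire–Milnor's Lemma 5.7 from its one-step content** (*Groups of homotopy spheres I*
(1963), p. 516: "the homology group `H_kM` can be reduced to its torsion subgroup by a sequence of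
spherical modifications. The modified manifold `M₁` will still satisfy the hypothesis"), for a
family of finitely generated abelian groups `G i` ("`H_kM`") indexed by stages `i` ("`M`
satisfying the Hypothesis") with a predicate `P`. GIVEN (`hkill`) the one-step content of its
printed proof — a generator `λ = x` of an infinite cyclic direct summand (`f x = 1` for some
`f : G i → ℤ`) is killed by passing to some stage: "Therefore `λ` is primitive, and can be killed by
a modification", i.e. (Assertion p. 516, Lemma 5.6) some `j` has `G j ≅ G i/λ(Z)` — one reaches a
stage whose group is isomorphic to the torsion subgroup `T` of `G i` ("After finitely many such
modifications, one obtains a manifold `M₁` with `H_kM₁ ≅ T ⊂ H_kM`"). Proof: induction on the rank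
(`exists_addMonoidHom_apply_eq_one_of_finrank_ne_zero`, `finrank_quotient_zmultiples_add_one`,
`nonempty_torsion_quotient_zmultiples_addEquiv_torsion`); in rank `0` the group is its own torsion
subgroup. [cite: KervaireMilnorAnnals1963, Lemma 5.7 (p. 516) and its proof] -/
theorem exists_addEquiv_torsion_of_killFree {ι : Type*} {G : ι → Type*}
    [∀ i, AddCommGroup (G i)] (P : ι → Prop) (hfin : ∀ i, P i → AddGroup.FG (G i))
    (hkill : ∀ i, P i → ∀ (x : G i) (f : G i →+ ℤ), f x = 1 →
      ∃ j, P j ∧ Nonempty (G j ≃+ G i ⧸ zmultiples x))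
    {i : ι} (hi : P i) : ∃ j, P j ∧ Nonempty (G j ≃+ AddCommGroup.torsion (G i)) := by
  -- induction on the rank
  have key : ∀ (r : ℕ) {i : ι}, P i → Module.finrank ℤ (G i) = r →
      ∃ j, P j ∧ Nonempty (G j ≃+ AddCommGroup.torsion (G i)) := by
    intro r
    induction r with
    | zero =>
      intro i hi hr
      -- rank `0`: `G i` is a torsion group, `G i = Torsion (G i)`
      haveI := hfin i hi
      haveI : Module.Finite ℤ (G i) := Module.Finite.iff_addGroup_fg.2 ‹_›
      have htor : AddCommGroup.torsion (G i) = ⊤ := by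
        rw [AddCommGroup.torsion_eq_top_iff]
        intro g
        obtain ⟨a, ha, hag⟩ := Module.finrank_eq_zero_iff.1 hr g
        exact (isOfFinAddOrder_iff_zsmul_eq_zero).2 ⟨a, ha, hag⟩
      exact ⟨i, hi, ⟨(AddSubgroup.topEquiv.symm.trans (AddEquiv.addSubgroupCongr htor.symm))⟩⟩
    | succ r ih =>
      intro i hi hr
      haveI := hfin i hi
      -- kill a generator `x` of an infinite cyclic summand: the rank drops, the torsion stays
      obtain ⟨x, f, hfx⟩ := exists_addMonoidHom_apply_eq_one_of_finrank_ne_zero (G i) (by omega)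
      obtain ⟨j, hj, ⟨e⟩⟩ := hkill i hi x f hfx
      have hrj : Module.finrank ℤ (G j) = r := by
        have h1 := finrank_quotient_zmultiples_add_one hfx
        have h2 := e.toIntLinearEquiv.finrank_eq
        omega
      obtain ⟨j', hj', ⟨e'⟩⟩ := ih hj hrj
      obtain ⟨e''⟩ := nonempty_torsion_quotient_zmultiples_addEquiv_torsion hfx
      -- `Torsion (G j) ≅ Torsion (G i ⧸ xℤ) ≅ Torsion (G i)`
      have e₃ : AddCommGroup.torsion (G j) ≃+ AddCommGroup.torsion (G i ⧸ zmultiples x) :=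
        (e.addSubgroupMap (AddCommGroup.torsion (G j))).trans
          (AddEquiv.addSubgroupCongr (e.map_torsion))
      exact ⟨j', hj', ⟨e'.trans (e₃.trans e'')⟩⟩
  exact key _ hi rfl

/-- **Kervaire–Milnor's iteration: "Proof of Theorem 5.1 for `k` even"** (*Groups of homotopy
spheres I* (1963), pp. 518–519), for a family of finitely generated abelian groups `G i` (the
groups `H_kM`) indexed by stages `i` (the manifolds `M` satisfying the Hypothesis of p. 516) with
a predicate `P`. GIVEN **Lemma 5.7** on stages (`h57`: from any stage one reaches a stage whose
group is isomorphic to the torsion subgroup of the given one; cf.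
`exists_addEquiv_torsion_of_killFree`) and **Lemmas 5.6 + 5.8** (`h568`: for every non-zero `λ`
one reaches a stage with `G i/λ(Z) ≅ G j/λ'(Z)` for some `λ'` — Lemma 5.6, "the quotient group
`H_kM/λ(Z)` is isomorphic to `H_kM'/λ'(Z)`" — and with a different rank — Lemma 5.8, "If `k` is
even then the modification `χ(φ)` necessarily changes the `k`ᵗʰ Betti number of `M`"), from every
stage one reaches a stage with trivial group. Printed proof, followed verbatim: after 5.7 the
group is a torsion group, i.e. finite; if it is not zero pick `λ ≠ 0` and modify: "Since the group
`λ(Z)` is finite, it follows from 5.8 that `λ'(Z)` must be infinite" (a group of rank `0` with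
finite quotient by a finite cyclic subgroup would be finite, of rank `0` again;
`finite_of_finite_quotient_zmultiples`, `finrank_int_eq_zero_of_finite`), "It follows that the
torsion subgroup of `H_kM'` maps monomorphically into `H_kM'/λ'(Z)`; and hence is definitely
smaller than `H_kM`" (`injective_torsion_to_quotient_zmultiples`;
`|H_kM'/λ'(Z)| = |H_kM/λ(Z)| = |H_kM|/|λ(Z)| < |H_kM|`), "Now according to 5.7, we can perform a
modification on `M'` so as to obtain a new manifold `M''` with `H_kM''` ≅ Torsion subgroup of
`H_kM' < H_kM`. Thus in two steps one can replace `H_kM` by a smaller group. Iterating this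
construction a finite number of times, the group `H_kM` can be killed completely" (strong
induction on the order). [cite: KervaireMilnorAnnals1963, proof of Thm. 5.1 for k even (pp. 518–519), with Lemmas 5.6, 5.7, 5.8] -/
theorem exists_subsingleton_of_torsionStep_of_rankStep {ι : Type*} {G : ι → Type*}
    [∀ i, AddCommGroup (G i)] (P : ι → Prop) (hfin : ∀ i, P i → AddGroup.FG (G i))
    (h57 : ∀ i, P i → ∃ j, P j ∧ Nonempty (G j ≃+ AddCommGroup.torsion (G i)))
    (h568 : ∀ i, P i → ∀ x : G i, x ≠ 0 → ∃ j, P j ∧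
      (∃ y : G j, Nonempty (G i ⧸ zmultiples x ≃+ G j ⧸ zmultiples y)) ∧
      Module.finrank ℤ (G j) ≠ Module.finrank ℤ (G i))
    {i : ι} (hi : P i) : ∃ j, P j ∧ Subsingleton (G j) := by
  -- (A) a stage whose group is isomorphic to a torsion group is finite (it is finitely generated)
  have hA : ∀ {i j : ι}, P j → (G j ≃+ AddCommGroup.torsion (G i)) → Finite (G j) := by
    intro i j hj e
    haveI := hfin j hj
    refine AddCommGroup.finite_of_fg_torsion (G j) fun g => ?_
    have h1 : IsOfFinAddOrder (e g : G i) := (AddCommGroup.mem_torsion _).1 (e g).2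
    have h2 : IsOfFinAddOrder (e g) := by
      rwa [← (AddCommGroup.torsion (G i)).subtype_injective.isOfFinAddOrder_iff
        (f := (AddCommGroup.torsion (G i)).subtype)]
    exact (e.injective.isOfFinAddOrder_iff (f := e.toAddMonoidHom)).1 h2
  -- (B) "in two steps one can replace `H_kM` by a smaller group": induction on the order
  have hB : ∀ (m : ℕ) {j : ι}, P j → Finite (G j) → Nat.card (G j) = m →
      ∃ l, P l ∧ Subsingleton (G l) := by
    intro m
    induction m using Nat.strong_induction_on with
    | _ m ih =>
      intro j hj hfj hcard
      by_cases hs : Subsingleton (G j)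
      · exact ⟨j, hj, hs⟩
      -- a non-trivial class `λ = x`
      obtain ⟨x, hx⟩ : ∃ x : G j, x ≠ 0 := by
        by_contra h
        push Not at h
        exact hs ⟨fun a b => by rw [h a, h b]⟩
      -- the modification on `x` (Lemmas 5.6, 5.8): the quotient is unchanged, the rank changes
      obtain ⟨j', hj', ⟨y, ⟨e⟩⟩, hrank⟩ := h568 j hj x hx
      -- so `G j'` is infinite and `λ' = y` has infinite order
      haveI hq : Finite (G j ⧸ zmultiples x) := inferInstance
      haveI hq' : Finite (G j' ⧸ zmultiples y) := Finite.of_equiv _ e.toEquiv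
      have hinf : ¬Finite (G j') := fun hf =>
        hrank ((finrank_int_eq_zero_of_finite (G j')).trans
          (finrank_int_eq_zero_of_finite (G j)).symm)
      have hy : ¬IsOfFinAddOrder y := fun hy => hinf (finite_of_finite_quotient_zmultiples hy)
      -- the torsion subgroup of `G j'` embeds in `G j' ⧸ ℤy ≅ G j ⧸ ℤx`, so is smaller than `G j`
      have hf := injective_torsion_to_quotient_zmultiples hy
      haveI hft : Finite (AddCommGroup.torsion (G j')) := Finite.of_injective _ hf
      have hlt : Nat.card (AddCommGroup.torsion (G j')) < m := by
        have h1 : Nat.card (AddCommGroup.torsion (G j')) ≤ Nat.card (G j ⧸ zmultiples x) :=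
          (Nat.card_le_card_of_injective _ hf).trans_eq (Nat.card_congr e.toEquiv.symm)
        have h2 := (zmultiples x).card_eq_card_quotient_mul_card_addSubgroup
        have h3 : 1 < Nat.card (zmultiples x) := by
          rw [Finite.one_lt_card_iff_nontrivial]
          exact ⟨⟨⟨x, mem_zmultiples x⟩, 0, fun h => hx (congrArg Subtype.val h)⟩⟩
        have h4 : 0 < Nat.card (G j ⧸ zmultiples x) := Nat.card_pos
        rw [← hcard, h2]
        nlinarith
      -- Lemma 5.7 on `M'`, and the induction hypothesis
      obtain ⟨j'', hj'', ⟨e'⟩⟩ := h57 j' hj'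
      haveI : Finite (G j'') := hA hj'' e'
      exact ih _ hlt hj'' this ((Nat.card_congr e'.toEquiv).trans rfl)
  -- (C) "According to 5.7, we can assume that `H_kM` is a torsion group"
  obtain ⟨j₁, hj₁, ⟨e₁⟩⟩ := h57 i hi
  exact hB _ hj₁ (hA hj₁ e₁) rfl

end Literature.GroupTheory.FiniteAbelian
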